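import Summits.AnomalousDissipation.AnomalousDissipation.Theorems.MirrorVarietyTaylorGreenLoudGalerkinStatesStubCriticality
import Summits.AnomalousDissipation.AnomalousDissipation.Theorems.MirrorVarietyTaylorGreenLoudGalerkinStatesStubDiscreteKantorovich
import Summits.AnomalousDissipation.AnomalousDissipation.Theorems.MirrorVarietyTaylorGreenLoudGalerkinStatesStubTgForceRegular
import Summits.AnomalousDissipation.AnomalousDissipation.Theorems.MirrorVarietyTaylorGreenLoudGalerkinStatesStubTruncation
import Literature.Analysis.FluidPDE.TorusForceBookkeeping

/-!
# Stub `stub_gaugeBackward` of the line `stagnation-plug-froth` (skeleton v4, gauge reshape)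
# (crux stmt-AnomalousDissipation-2987, `MirrorVariety.TaylorGreenLoudGalerkinStates`)

**The frozen-cell amplitude gauge, backward direction** (honesty lemma of the reshape): every
`K`-symmetric steady state `U` of NS(`ν`, `f_TG`) — `ν > 0`, `U` a `K`-field, tested equations
`testedForm ν f_TG U a = 0` against every `K`-field `a` — is a rescaled frozen-cell solution.

* `energy_identity` — test with `a := U`: antisymmetry `∫⟪U,(U·∇)U⟫ = 0`
  (`Torus.integral_inner_convect_eq_neg`) and Green `∫⟪U,ΔU⟫ = -‖∇U‖²`
  (`Torus.integral_inner_laplacian_eq_neg_holds`) give `ν‖∇U‖² = w := ∫⟪f_TG, U⟫`.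
* `injection_pos` — `0 < w`: otherwise `‖∇U‖² = 0`, so `U = 0` by Poincaré for mean-zero fields
  (`Torus.integral_norm_sq_le_card_pow_mul_gradNormSq`), and testing with `a := f_TG` gives
  `∫‖f_TG‖² = 1/4 = 0` (`integral_norm_sq_tgForce`), absurd.
* `isKField_gauge` — `v := θ⁻¹•U − 2•f_TG` (`θ := 2w`) is a `K`-field (closure of `K`-fields under
  real linear combinations).
* `integral_inner_tgForce_gauge` — `∫⟪f_TG, c•U − 2•f_TG⟫ = c·w − 1/2`, which vanishes at `c = θ⁻¹`.
* `testedForm_smul_state` — the one-line covariance in the state: `testedForm μ f (c•U) b =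
  c²∫⟪U,(U·∇)b⟫ + μc∫⟪U,Δb⟫ + ∫⟪f,b⟫`; with `μ := ν/θ`, `c := θ⁻¹` and `b ⊥ f_TG` this is
  `θ⁻²·testedForm ν f U b = 0`.

Sources: the vocabulary module `Theorems/MirrorVarietyTaylorGreenLoudGalerkinStatesLine.lean`
(`testedForm`, `IsKField`); `Theorems/TaylorGreenLoudGalerkinStates/Negative/LoadBearing.lean`
(`energy_identity` for the band-limited bracket, whose three-line pattern is adapted here) and
`…/Negative/Anatomy.lean` (`integral_norm_sq_tgForce`); the landed stub files `…StubTgForceRegular.lean`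
(`IsKField tgForce`), `…StubDiscreteKantorovich.lean` (`isKSymm_add/smul`), `…StubTruncation.lean`
(`testedForm_eq_add`, `eq_zero_of_integral_norm_sq_eq_zero`). Mathematics: R. Temam, *Navier–Stokes
Equations* (1979), Ch. II §1, (1.29) (energy identity of steady states); the gauge is folklore
(idea card `Cruxes/TaylorGreenLoudGalerkinStates/Ideas/frozen-cell-amplitude-gauge.md`).
-/

-- `Summit.<Summit>.<Problem>` is the tree's mandated summit-side namespace (CONVENTIONS §2); for this
-- single-conjunct summit the two coincide, so the duplicate is deliberate.
set_option linter.dupNamespace false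

noncomputable section

open scoped BigOperators Topology InnerProductSpace
open Filter MeasureTheory
open Literature.Analysis.FunctionSpaces Literature.Analysis.FunctionSpaces.Torus

namespace Summit.AnomalousDissipation.AnomalousDissipation.Theorems.TaylorGreenLoudGalerkinStates.GaugeBackward

open Summit.AnomalousDissipation.AnomalousDissipation.Theorems.TaylorGreenLoudGalerkinStates
open Summit.AnomalousDissipation.AnomalousDissipation.Theorems.TaylorGreenLoudGalerkinStates.Negative

/-! ## The energy identity and positivity of the injection -/

/-- **Energy identity for `K`-tested steady states.** If the `K`-field `U` satisfies
`testedForm ν f_TG U a = 0` for every `K`-field `a`, then `ν‖∇U‖² = ∫⟪f_TG, U⟫`: test with `a := U`,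
use the antisymmetry `∫⟪U,(U·∇)U⟫ = 0` and Green `∫⟪U,ΔU⟫ = -‖∇U‖²` (Temam 1979, Ch. II (1.29)).
[folklore] -/
theorem energy_identity {ν : ℝ} {U : UnitAddTorus (Fin 3) → EuclideanSpace ℝ (Fin 3)} (hU : IsKField U)
    (htest : ∀ a, IsKField a → testedForm ν tgForce U a = 0) :
    ν * gradNormSq U = ∫ x, ⟪tgForce x, U x⟫_ℝ := by
  -- adapted from `Negative.energy_identity` (Theorems/TaylorGreenLoudGalerkinStates/Negative/LoadBearing.lean)
  have hs : IsSmooth U := hU.1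
  have hdiv : IsDivFree U := hU.2.1
  have h := htest U hU
  rw [Truncation.testedForm_eq_add ν isSmooth_tgForce hs hs] at h
  have h1 : ∫ x, ⟪U x, convect U U x⟫_ℝ = 0 := by
    have ha := integral_inner_convect_eq_neg hs hdiv hs hs
    have hc : ∫ x, ⟪convect U U x, U x⟫_ℝ = ∫ x, ⟪U x, convect U U x⟫_ℝ :=
      integral_congr_ae (ae_of_all _ fun x => real_inner_comm _ _)
    linarith
  have h2 : ∫ x, ⟪U x, laplacian U x⟫_ℝ = -gradNormSq U := by
    have hint : ∀ i, Integrable (fun x => ‖partialDeriv i U x‖ ^ 2) volume := fun i =>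
      ((hs.partialDeriv i).continuous.norm.pow 2).integrable_unitAddTorus
    rw [integral_inner_laplacian_eq_neg_holds hs, gradNormSq, integral_finsetSum _ fun i _ => hint i]
  rw [h1, h2] at h
  linarith

/-- The tested form of the ZERO state against the force itself is `∫‖f_TG‖² = 1/4`. [folklore] -/
theorem testedForm_zero_tgForce (ν : ℝ) : testedForm ν tgForce 0 tgForce = 4⁻¹ := by
  simp only [testedForm, Pi.zero_apply, inner_zero_left, mul_zero, zero_add, real_inner_self_eq_norm_sq]
  exact integral_norm_sq_tgForce

/-- **Positivity of the injection.** For `ν > 0` and a `K`-tested steady state `U` of NS(`ν`, `f_TG`),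
`0 < ∫⟪f_TG, U⟫`: by the energy identity the injection is `ν‖∇U‖² ≥ 0`, and if it vanished then
`‖∇U‖² = 0`, so the mean-zero field `U` vanishes (Poincaré), and testing with `a := f_TG` would give
`∫‖f_TG‖² = 1/4 = 0`. [folklore] -/
theorem injection_pos {ν : ℝ} {U : UnitAddTorus (Fin 3) → EuclideanSpace ℝ (Fin 3)} (hν : 0 < ν)
    (hU : IsKField U) (htest : ∀ a, IsKField a → testedForm ν tgForce U a = 0) :
    0 < ∫ x, ⟪tgForce x, U x⟫_ℝ := by
  have hE := energy_identity hU htest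
  have hs : IsSmooth U := hU.1
  have h0 : 0 ≤ ∫ x, ⟪tgForce x, U x⟫_ℝ := by
    rw [← hE]
    exact mul_nonneg hν.le (gradNormSq_nonneg U)
  rcases h0.lt_or_eq with hpos | hzero
  · exact hpos
  · exfalso
    have hg : gradNormSq U = 0 :=
      (mul_eq_zero.1 (hE.trans hzero.symm)).resolve_left hν.ne'
    have hP := integral_norm_sq_le_card_pow_mul_gradNormSq hs hU.2.2.1
    rw [hg, mul_zero] at hP
    have hL2 : ∫ x, ‖U x‖ ^ 2 = 0 := le_antisymm hP (integral_nonneg fun x => sq_nonneg _)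
    have hU0 : U = 0 := Truncation.eq_zero_of_integral_norm_sq_eq_zero hs.continuous hL2
    have h := htest tgForce TgForceRegular.stub_tgForceRegular
    rw [hU0, testedForm_zero_tgForce] at h
    norm_num at h

/-! ## The gauge field `c•U − 2•f_TG` -/

/-- **`K`-fields are closed under the gauge combination**: for a `K`-field `U` and any real `c`,
`c•U − 2•f_TG` is a `K`-field (smooth, divergence-free, mean-zero, `K`-symmetric — all four are
real-linear conditions, and `f_TG` is a `K`-field). [folklore] -/
theorem isKField_gauge (c : ℝ) {U : UnitAddTorus (Fin 3) → EuclideanSpace ℝ (Fin 3)} (hU : IsKField U) :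
    IsKField (c • U - (2 : ℝ) • tgForce) := by
  obtain ⟨hs, hdiv, h0, hk⟩ := hU
  obtain ⟨hfs, hfdiv, hf0, hfk⟩ := TgForceRegular.stub_tgForceRegular
  refine ⟨(hs.smul c).sub (hfs.smul 2), ?_, ?_, ?_⟩
  · intro x
    have h1 : IsContDiff 1 (c • U) := (hs.smul c).isContDiff (by simp)
    have h2 : IsContDiff 1 ((2 : ℝ) • tgForce) := (hfs.smul 2).isContDiff (by simp)
    rw [divergence_sub h1 h2,
      Literature.Analysis.FluidPDE.Torus.isDivFree_const_smul (hs.isContDiff (by simp)) hdiv c x,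
      Literature.Analysis.FluidPDE.Torus.isDivFree_const_smul (hfs.isContDiff (by simp)) hfdiv 2 x, sub_zero]
  · have e1 : ∫ x, (c • U) x = 0 := Literature.Analysis.FluidPDE.Torus.hasZeroMean_const_smul h0 c
    have e2 : ∫ x, ((2 : ℝ) • tgForce) x = 0 := Literature.Analysis.FluidPDE.Torus.hasZeroMean_const_smul hf0 2
    show ∫ x, (c • U - (2 : ℝ) • tgForce) x = 0
    simp only [Pi.sub_apply]
    rw [integral_sub (hs.smul c).integrable (hfs.smul 2).integrable, e1, e2, sub_zero]
  · have e : c • U - (2 : ℝ) • tgForce = c • U + (-2 : ℝ) • tgForce := by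
      rw [sub_eq_add_neg, ← neg_smul]
    rw [e]
    exact DiscreteKantorovich.isKSymm_add (DiscreteKantorovich.isKSymm_smul c hk)
      (DiscreteKantorovich.isKSymm_smul (-2) hfk)

/-- **Injection of the gauge field**: `∫⟪f_TG, c•U − 2•f_TG⟫ = c·∫⟪f_TG, U⟫ − 1/2`
(`∫‖f_TG‖² = 1/4`). [folklore] -/
theorem integral_inner_tgForce_gauge (c : ℝ) {U : UnitAddTorus (Fin 3) → EuclideanSpace ℝ (Fin 3)}
    (hs : IsSmooth U) :
    ∫ x, ⟪tgForce x, (c • U - (2 : ℝ) • tgForce) x⟫_ℝ = c * (∫ x, ⟪tgForce x, U x⟫_ℝ) - 2⁻¹ := by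
  have hfs : IsSmooth tgForce := isSmooth_tgForce
  have i1 : Integrable (fun x => c * ⟪tgForce x, U x⟫_ℝ) volume := (hfs.inner hs).integrable.const_mul c
  have i2 : Integrable (fun x => (2 : ℝ) * ⟪tgForce x, tgForce x⟫_ℝ) volume :=
    (hfs.inner hfs).integrable.const_mul 2
  have hpt : (fun x => ⟪tgForce x, (c • U - (2 : ℝ) • tgForce) x⟫_ℝ) =
      fun x => c * ⟪tgForce x, U x⟫_ℝ - 2 * ⟪tgForce x, tgForce x⟫_ℝ := by
    funext x
    rw [Pi.sub_apply, Pi.smul_apply, Pi.smul_apply, inner_sub_right, real_inner_smul_right,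
      real_inner_smul_right]
  have hff : ∫ x, ⟪tgForce x, tgForce x⟫_ℝ = 4⁻¹ := by
    simp_rw [real_inner_self_eq_norm_sq]
    exact integral_norm_sq_tgForce
  rw [hpt, integral_sub i1 i2, integral_const_mul, integral_const_mul, hff]
  norm_num

/-- `2•f_TG + (c•U − 2•f_TG) = c•U` as functions. [folklore] -/
theorem two_smul_tgForce_add_gauge (c : ℝ) (U : UnitAddTorus (Fin 3) → EuclideanSpace ℝ (Fin 3)) :
    (2 : ℝ) • tgForce + (c • U - (2 : ℝ) • tgForce) = c • U := by
  rw [add_comm, sub_add_cancel]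

/-! ## Covariance of the tested form in the state -/

/-- **Scaling the state** (the one-line covariance needed here): for smooth `f`, `U`, `b` and reals
`μ`, `c`, `testedForm μ f (c•U) b = c²∫⟪U,(U·∇)b⟫ + μc∫⟪U,Δb⟫ + ∫⟪f,b⟫` — `(c•U·∇)b = c•(U·∇)b`
pointwise since `Torus.fderiv b x` is linear. [folklore] -/
theorem testedForm_smul_state (μ c : ℝ) {f U b : UnitAddTorus (Fin 3) → EuclideanSpace ℝ (Fin 3)}
    (hf : IsSmooth f) (hs : IsSmooth U) (hb : IsSmooth b) :
    testedForm μ f (c • U) b =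
      c ^ 2 * (∫ x, ⟪U x, convect U b x⟫_ℝ) + μ * c * (∫ x, ⟪U x, laplacian b x⟫_ℝ) + ∫ x, ⟪f x, b x⟫_ℝ := by
  rw [Truncation.testedForm_eq_add μ hf (hs.smul c) hb]
  have h1 : (∫ x, ⟪(c • U) x, convect (c • U) b x⟫_ℝ) = c ^ 2 * ∫ x, ⟪U x, convect U b x⟫_ℝ := by
    rw [← integral_const_mul]
    refine integral_congr_ae (ae_of_all _ fun x => ?_)
    simp only [convect, Pi.smul_apply, map_smul, real_inner_smul_left, real_inner_smul_right]
    ring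
  have h2 : (∫ x, ⟪(c • U) x, laplacian b x⟫_ℝ) = c * ∫ x, ⟪U x, laplacian b x⟫_ℝ := by
    rw [← integral_const_mul]
    refine integral_congr_ae (ae_of_all _ fun x => ?_)
    simp only [Pi.smul_apply, real_inner_smul_left]
  rw [h1, h2]
  ring

/-! ## The registered stub -/

/-- **Stub `stub_gaugeBackward`** (the gauge, backward direction; honesty lemma).  Every `K`-symmetric
steady state `U` of NS(`ν`, `f_TG`) (`ν > 0`, `K`-tested equations) has positive injection
`w = ∫⟪f_TG, U⟫` (`= ν‖∇U‖²` by the energy identity, and `U ≠ 0` since `∫‖f_TG‖² = 1/4 ≠ 0`), and with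
`θ := 2w` the field `v := θ⁻¹•U − 2•f_TG` is a `K`-field orthogonal to the force (`θ⁻¹w − 2·¼ = 0`)
such that `2•f_TG + v = θ⁻¹•U` solves the frozen-cell equations at gauge viscosity `ν/θ` against every
`K`-field `b ⊥ f_TG` (covariance `testedForm (ν/θ) f (θ⁻¹•U) b = θ⁻²·testedForm ν f U b` when `∫⟪f,b⟫ = 0`).
[folklore] -/
theorem stub_gaugeBackward :
    ∀ (ν : ℝ) (U : UnitAddTorus (Fin 3) → EuclideanSpace ℝ (Fin 3)), 0 < ν → IsKField U →
      (∀ a, IsKField a → testedForm ν tgForce U a = 0) →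
      0 < ∫ x, inner ℝ (tgForce x) (U x) ∧
      IsKField ((1 / (2 * ∫ x, inner ℝ (tgForce x) (U x))) • U - (2 : ℝ) • tgForce) ∧
      (∫ x, inner ℝ (tgForce x) (((1 / (2 * ∫ x, inner ℝ (tgForce x) (U x))) • U - (2 : ℝ) • tgForce) x)) = 0 ∧
      ∀ b, IsKField b → (∫ x, inner ℝ (tgForce x) (b x)) = 0 →
        testedForm (ν / (2 * ∫ x, inner ℝ (tgForce x) (U x))) tgForce
          ((2 : ℝ) • tgForce + ((1 / (2 * ∫ x, inner ℝ (tgForce x) (U x))) • U - (2 : ℝ) • tgForce)) b = 0 := by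
  intro ν U hν hU htest
  have hfs : IsSmooth tgForce := isSmooth_tgForce
  have hs : IsSmooth U := hU.1
  have hw : 0 < ∫ x, ⟪tgForce x, U x⟫_ℝ := injection_pos hν hU htest
  set w : ℝ := ∫ x, ⟪tgForce x, U x⟫_ℝ with hw_def
  have hcw : 1 / (2 * w) * w = 2⁻¹ := by
    field_simp
  refine ⟨hw, isKField_gauge _ hU, ?_, ?_⟩
  · rw [integral_inner_tgForce_gauge _ hs, hcw, sub_self]
  · intro b hb hfb
    have h := htest b hb
    rw [Truncation.testedForm_eq_add ν hfs hs hb.1, hfb] at h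
    rw [two_smul_tgForce_add_gauge, testedForm_smul_state _ _ hfs hs hb.1, hfb]
    have hνc : ν / (2 * w) = ν * (1 / (2 * w)) := by
      rw [mul_one_div]
    rw [hνc]
    linear_combination (1 / (2 * w)) ^ 2 * h

end Summit.AnomalousDissipation.AnomalousDissipation.Theorems.TaylorGreenLoudGalerkinStates.GaugeBackward

end
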